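import Literature.NumberTheory.EllipticCurves.EtaDuodecicLevelFour
import Literature.NumberTheory.EllipticCurves.ModularFunctionFieldPointValues
import Mathlib.NumberTheory.ModularForms.LevelOne.GradedRing
import HarnessLib

/-!
# Weber's `γ₃(2τ) = E₆(2τ)/η(2τ)¹²` as an element of the function field `K_4 = ℂ(X₀(4))`
# (Cox, *Primes of the form x² + ny²*, §12.B: `γ₃(τ)² = j(τ) − 1728`)

Topic `NumberTheory/EllipticCurves` (modular functions of level `Γ₀(4)` / complex multiplication),
namespace `Literature.NumberTheory.EllipticCurves.ModularForms`.  Definitions with bodies, all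
statements proved, no named fact.  Companion of `WeberGamma2LevelNine.lean` (`γ₂(3τ) ∈ K_9`).

With `η(2τ)¹² ∈ S₆(Γ₀(4))` (`EtaDuodecicLevelFour.lean`) and `E₄(2τ), E₆(2τ), Δ(2τ)` (the tree's
`scaleN`, restricted from `Γ₀(2)` by `ofLevelLe`):

* `E₄TwoFour`, `E₆TwoFour`, `deltaTwoFour`, `weberFourNum = E₆(2τ)η(2τ)¹²`,
  `kleinJSubNum = E₄(2τ)³ − 1728Δ(2τ)` (forms of weight `4, 6, 12, 12, 12` for `Γ₀(4)`);
* `weberFourFn = E₆(2τ)η(2τ)¹²/Δ(2τ) ∈ K_4` — **Weber's `γ₃(2τ) = E₆(2τ)/η(2τ)¹²` as a modular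
  function of level `4`** — and `kleinJSubFn = (E₄(2τ)³ − 1728Δ(2τ))/Δ(2τ) = j(2τ) − 1728 ∈ K_4`;
* `pointValuation_weberFourFn_sub_lt_one` — `γ₃(2τ)` is regular at every `τ ∈ ℍ` with value
  `E₆(2τ)/η(2τ)¹²`;
* `weberFourFn_sq` — **`γ₃(2τ)² = j(2τ) − 1728` in `K_4`** (Mathlib's
  `discriminant_eq_E₄_cube_sub_E₆_sq`: `E₄³ − E₆² = 1728Δ`).

## References

* D. A. Cox, *Primes of the form x² + ny²*, 2nd ed., 2013, §12.B (Weber's `γ₃`, `γ₃² = j − 1728`).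
  [Cox2013]
* F. Diamond, J. Shurman, *A First Course in Modular Forms*, GTM 228, 2005, §7.5. [DiamondShurman2005]
-/

noncomputable section

open UpperHalfPlane hiding I
open Complex ModularForm CongruenceSubgroup Matrix.SpecialLinearGroup EisensteinSeries
open scoped MatrixGroups Real ModularForm Manifold

namespace Literature.NumberTheory.EllipticCurves.ModularForms

/-! ### The level-`4` forms -/

/-- `E₄(2τ)` as a modular form of weight `4` for `Γ₀(4)`. [folklore] -/
def E₄TwoFour : ModularForm (Gamma0 4) 4 :=
  ofLevelLe Gamma0_four_le_two (scaleN 2 E₄)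

/-- `E₄TwoFour τ = E₄(2τ)`. [folklore] -/
@[simp] theorem E₄TwoFour_apply (τ : ℍ) : E₄TwoFour τ = E₄ (tpD 2 • τ) := rfl

/-- `E₆(2τ)` as a modular form of weight `6` for `Γ₀(4)`. [folklore] -/
def E₆TwoFour : ModularForm (Gamma0 4) 6 :=
  ofLevelLe Gamma0_four_le_two (scaleN 2 E₆)

/-- `E₆TwoFour τ = E₆(2τ)`. [folklore] -/
@[simp] theorem E₆TwoFour_apply (τ : ℍ) : E₆TwoFour τ = E₆ (tpD 2 • τ) := rfl

/-- `Δ(2τ)` as a modular form of weight `12` for `Γ₀(4)`. [folklore] -/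
def deltaTwoFour : ModularForm (Gamma0 4) 12 :=
  ofLevelLe Gamma0_four_le_two (scaleN 2 delta)

/-- `deltaTwoFour τ = Δ(2τ)`. [folklore] -/
@[simp] theorem deltaTwoFour_apply (τ : ℍ) :
    deltaTwoFour τ = ModularForm.discriminant (tpD 2 • τ) := rfl

/-- `Δ(2τ) = η(2τ)²⁴`. [folklore] -/
theorem deltaTwoFour_apply_eq_eta_pow (τ : ℍ) : deltaTwoFour τ = η (2 * (τ : ℂ)) ^ 24 := by
  rw [deltaTwoFour_apply, ModularForm.discriminant, coe_tpD_smul]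
  push_cast
  ring_nf

/-- `Δ(2τ) ≠ 0` pointwise. [folklore] -/
theorem deltaTwoFour_apply_ne_zero (τ : ℍ) : deltaTwoFour τ ≠ 0 := by
  rw [deltaTwoFour_apply]
  exact ModularForm.discriminant_ne_zero _

/-- `Δ(2τ) ≠ 0` as a form. [folklore] -/
theorem deltaTwoFour_ne_zero : deltaTwoFour ≠ 0 := fun h ↦ by
  have := congrArg (fun f : ModularForm (Gamma0 4) 12 ↦ f UpperHalfPlane.I) h
  exact deltaTwoFour_apply_ne_zero _ (by simpa using this)

/-- The numerator `E₆(2τ)·η(2τ)¹²` of weight `12`. [folklore] -/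
def weberFourNum : ModularForm (Gamma0 4) 12 :=
  (E₆TwoFour.mul etaDuodecicFourForm).mcast (by norm_num)

/-- The underlying function of `weberFourNum` is `E₆(2τ) · η(2τ)¹²`. [folklore] -/
theorem coe_weberFourNum : (⇑weberFourNum : ℍ → ℂ) = ⇑E₆TwoFour * ⇑etaDuodecicFourForm := rfl

/-- `weberFourNum τ = E₆(2τ) η(2τ)¹²`. [folklore] -/
@[simp] theorem weberFourNum_apply (τ : ℍ) :
    weberFourNum τ = E₆ (tpD 2 • τ) * η (2 * (τ : ℂ)) ^ 12 := by
  rw [show weberFourNum τ = (⇑weberFourNum : ℍ → ℂ) τ from rfl, coe_weberFourNum]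
  simp only [Pi.mul_apply, E₆TwoFour_apply, etaDuodecicFourForm_apply]

/-- `E₄(2τ)³` of weight `12`. [folklore] -/
def E₄TwoFourCube : ModularForm (Gamma0 4) 12 :=
  ((E₄TwoFour.mul E₄TwoFour).mul E₄TwoFour).mcast (by norm_num)

/-- The underlying function of `E₄TwoFourCube`. [folklore] -/
theorem coe_E₄TwoFourCube :
    (⇑E₄TwoFourCube : ℍ → ℂ) = ⇑E₄TwoFour * ⇑E₄TwoFour * ⇑E₄TwoFour := rfl

/-- `E₄TwoFourCube τ = E₄(2τ)³`. [folklore] -/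
@[simp] theorem E₄TwoFourCube_apply (τ : ℍ) : E₄TwoFourCube τ = E₄ (tpD 2 • τ) ^ 3 := by
  rw [show E₄TwoFourCube τ = (⇑E₄TwoFourCube : ℍ → ℂ) τ from rfl, coe_E₄TwoFourCube]
  simp only [Pi.mul_apply, E₄TwoFour_apply]
  ring

/-- The numerator `E₄(2τ)³ − 1728 Δ(2τ)` of `j(2τ) − 1728`, of weight `12`. [folklore] -/
def kleinJSubNum : ModularForm (Gamma0 4) 12 :=
  E₄TwoFourCube - (1728 : ℂ) • deltaTwoFour

/-- `kleinJSubNum τ = E₄(2τ)³ − 1728 Δ(2τ) = E₆(2τ)²`. [folklore] -/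
theorem kleinJSubNum_apply (τ : ℍ) : kleinJSubNum τ = E₆ (tpD 2 • τ) ^ 2 := by
  have h : kleinJSubNum τ = E₄TwoFourCube τ - 1728 * deltaTwoFour τ := by
    simp [kleinJSubNum, sub_eq_add_neg]
  rw [h, E₄TwoFourCube_apply, deltaTwoFour_apply, ModularForm.discriminant_eq_E₄_cube_sub_E₆_sq]
  ring

/-! ### The elements `γ₃(2τ)` and `j(2τ) − 1728` of `K_4` -/

/-- **Weber's `γ₃(2τ)` as an element of `K_4 = ℂ(X₀(4))`**: the class of
`E₆(2τ)η(2τ)¹² / Δ(2τ) = E₆(2τ)/η(2τ)¹²`. [cite: Cox2013, §12.B] -/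
def weberFourFn : modularFunctionField 4 :=
  mkFn weberFourNum deltaTwoFour deltaTwoFour_ne_zero

/-- **`j(2τ) − 1728` as an element of `K_4`**: the class of `(E₄(2τ)³ − 1728Δ(2τ))/Δ(2τ)`. [folklore] -/
def kleinJSubFn : modularFunctionField 4 :=
  mkFn kleinJSubNum deltaTwoFour deltaTwoFour_ne_zero

/-- `j(2τ)` as an element of `K_4`. [folklore] -/
def kleinJTwoFourFn : modularFunctionField 4 :=
  mkFn E₄TwoFourCube deltaTwoFour deltaTwoFour_ne_zero

/-- `(j(2τ) − 1728) = j(2τ) − 1728` in `K_4`. [folklore] -/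
theorem kleinJSubFn_eq : kleinJSubFn = kleinJTwoFourFn - algebraMap ℂ (modularFunctionField 4) 1728 := by
  rw [kleinJTwoFourFn, mkFn_sub_algebraMap]
  rfl

/-- **The value of `γ₃(2τ) ∈ K_4` at `τ` is `E₆(2τ)/η(2τ)¹²`**, at every point of `ℍ`. [cite: Cox2013, §12.B] -/
theorem pointValuation_weberFourFn_sub_lt_one (τ : ℍ) :
    pointValuation (N := 4) τ (weberFourFn - algebraMap ℂ (modularFunctionField 4)
      (E₆ (tpD 2 • τ) / η (2 * (τ : ℂ)) ^ 12)) < 1 := by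
  apply pointValuation_mkFn_sub_lt_one_of_orderAt_lt
  set c : ℂ := E₆ (tpD 2 • τ) / η (2 * (τ : ℂ)) ^ 12 with hc
  set G : ModularForm (Gamma0 4) 12 := weberFourNum - c • deltaTwoFour with hG
  by_cases hG0 : G = 0
  · exact Or.inl hG0
  · right
    have hη : η (2 * (τ : ℂ)) ≠ 0 :=
      ModularForm.eta_ne_zero (by simpa using mul_pos (by norm_num : (0:ℝ) < 2) τ.2)
    have hGτ : G τ = 0 := by
      have h1 : G τ = weberFourNum τ - c * deltaTwoFour τ := by
        simp [hG, sub_eq_add_neg]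
      rw [h1, weberFourNum_apply, deltaTwoFour_apply_eq_eta_pow, hc]
      field_simp
      ring
    rw [(orderAt_eq_zero_iff deltaTwoFour_ne_zero τ).mpr (deltaTwoFour_apply_ne_zero τ)]
    exact Nat.pos_of_ne_zero fun h0 ↦ (orderAt_eq_zero_iff hG0 τ).mp h0 hGτ

/-- **The value of `j(2τ) − 1728 ∈ K_4` at `τ` is `E₆(2τ)²/Δ(2τ)`.** [folklore] -/
theorem pointValuation_kleinJSubFn_sub_lt_one (τ : ℍ) :
    pointValuation (N := 4) τ (kleinJSubFn - algebraMap ℂ (modularFunctionField 4)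
      (E₆ (tpD 2 • τ) ^ 2 / ModularForm.discriminant (tpD 2 • τ))) < 1 := by
  apply pointValuation_mkFn_sub_lt_one_of_orderAt_lt
  set c : ℂ := E₆ (tpD 2 • τ) ^ 2 / ModularForm.discriminant (tpD 2 • τ) with hc
  set G : ModularForm (Gamma0 4) 12 := kleinJSubNum - c • deltaTwoFour with hG
  by_cases hG0 : G = 0
  · exact Or.inl hG0
  · right
    have hGτ : G τ = 0 := by
      have h1 : G τ = kleinJSubNum τ - c * deltaTwoFour τ := by
        simp [hG, sub_eq_add_neg]
      rw [h1, kleinJSubNum_apply, deltaTwoFour_apply, hc,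
        div_mul_cancel₀ _ (ModularForm.discriminant_ne_zero _), sub_self]
    rw [(orderAt_eq_zero_iff deltaTwoFour_ne_zero τ).mpr (deltaTwoFour_apply_ne_zero τ)]
    exact Nat.pos_of_ne_zero fun h0 ↦ (orderAt_eq_zero_iff hG0 τ).mp h0 hGτ

/-- As forms of weight `36`: `weberFourNum² · Δ₂ = kleinJSubNum · Δ₂²` — pointwise
`E₆²η²⁴·η²⁴ = E₆²·η⁴⁸`. [folklore] -/
theorem weberFourNum_sq_mul_delta :
    ((weberFourNum.mul weberFourNum).mul deltaTwoFour : ModularForm (Gamma0 4) (12 + 12 + 12)) =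
      (kleinJSubNum.mul deltaTwoFour).mul deltaTwoFour := by
  apply DFunLike.ext
  intro τ
  simp only [ModularForm.coe_mul, Pi.mul_apply, weberFourNum_apply, kleinJSubNum_apply,
    deltaTwoFour_apply_eq_eta_pow]
  ring

/-- **`γ₃(2τ)² = j(2τ) − 1728` in `K_4`.** [cite: Cox2013, §12.B (`γ₃(τ)² = j(τ) − 1728`)] -/
theorem weberFourFn_sq : weberFourFn ^ 2 = kleinJSubFn := by
  apply Subtype.ext
  have hΔ : qExpansionL 4 deltaTwoFour ≠ 0 := (qExpansionL_eq_zero_iff 4 _).not.mpr deltaTwoFour_ne_zero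
  change ((qExpansionL 4 weberFourNum / qExpansionL 4 deltaTwoFour) ^ 2 : LaurentSeries ℂ) =
    qExpansionL 4 kleinJSubNum / qExpansionL 4 deltaTwoFour
  have key : qExpansionL 4 weberFourNum ^ 2 * qExpansionL 4 deltaTwoFour =
      qExpansionL 4 kleinJSubNum * qExpansionL 4 deltaTwoFour ^ 2 := by
    have h := congrArg (qExpansionL 4) weberFourNum_sq_mul_delta
    simp only [qExpansionL_mul] at h
    calc qExpansionL 4 weberFourNum ^ 2 * qExpansionL 4 deltaTwoFour
        = qExpansionL 4 weberFourNum * qExpansionL 4 weberFourNum * qExpansionL 4 deltaTwoFour := by ring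
      _ = qExpansionL 4 kleinJSubNum * qExpansionL 4 deltaTwoFour * qExpansionL 4 deltaTwoFour := h
      _ = qExpansionL 4 kleinJSubNum * qExpansionL 4 deltaTwoFour ^ 2 := by ring
  rw [div_pow, div_eq_div_iff (pow_ne_zero 2 hΔ) hΔ]
  exact key

end Literature.NumberTheory.EllipticCurves.ModularForms

end
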